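import Literature.Probability.RandomPlanarGeometry.CurveTortuosity
import HarnessLib

/-!
# Compact sets of curve classes traverse a genuine shell boundedly often

Topic `Literature/Probability/RandomPlanarGeometry`. The CONVERSE bookkeeping of the
Aizenman–Burchard regularity criterion (`CurveTortuosity.lean`, `CurveTightness.lean`): there, power
bounds on `k`-fold shell traversals give tightness; here, conversely, on a compact set of curves
modulo reparametrisation every genuine shell `D(x; r, R)`, `r < R`, is traversed by a BOUNDED number
of separate segments (Aizenman–Burchard, Duke Math. J. 99 (1999), §1–§2: on a compact family the
moduli of continuity up to reparametrisation are uniform, so the number of disjoint segments joining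
the two boundary spheres of a shell is uniformly bounded). Consequence for users of
`isTightMeasureSet_of_traversalBounds` with a shell-dependent threshold `k x ρ R`: a tight family of
curve laws satisfies the hypothesis (H1) back, shell by shell (tightness ⇒ compact set ⇒ bounded
traversal count), i.e. with free thresholds (H1) is a REFORMULATION of tightness, not a strengthening.

## Contents

* `CurveClass.exists_not_hasTraversals_of_isCompact` — for compact `𝒦 ⊆ CurveClass E` and
  `r < R` there is `k` such that no curve whose class lies in `𝒦` traverses `D(x; r, R)` `k` times
  (finite subcover by `(R - r)/3`-balls + `Curve.exists_not_hasTraversals` for one representative per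
  centre; the reparametrisation invariance and the `ε`-room transfer it needs are private local
  copies of `Curve.HasTraversals.of_reparam` / `.of_dist_lt` of
  `Literature/Probability/Percolation/AltFourArmLiminfFromLoops.lean`).

Nothing probabilistic is here; the measure-theoretic corollary (tight laws ⇒ (H1) with free
thresholds) is two lines at the point of use (`isTightMeasureSet_iff_exists_isCompact_measure_compl_le`).
-/

noncomputable section

namespace Literature.Probability.RandomPlanarGeometry

variable {E : Type*} [PseudoMetricSpace E]

namespace Curve

variable {γ γ₁ γ₂ : Curve E} {k : ℕ} {x : E} {r R ε : ℝ}

/-- (local helper; the public versions `Curve.HasTraversals.of_reparam` / `.of_dist_lt` live in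
`Literature/Probability/Percolation/AltFourArmLiminfFromLoops.lean`, not imported here to keep this
file light) traversals of a reparametrised curve are traversals of the curve.
[cite: AizenmanBurchard1999, §2.a] -/
private theorem hasTraversals_of_reparam_aux (φ : unitInterval ≃o unitInterval)
    (h : (γ.reparam φ).HasTraversals k x r R) : γ.HasTraversals k x r R := by
  obtain ⟨s, t, hst, hsep⟩ := h
  refine ⟨fun i => φ (s i), fun i => φ (t i), fun i => ?_, fun i j hij => φ.strictMono (hsep hij)⟩
  obtain ⟨hle, h⟩ := hst i
  exact ⟨φ.monotone hle, by simpa [Curve.reparam_apply] using h⟩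

/-- (local helper, see above) traversals pass to nearby curves with an `ε` of room.
[cite: AizenmanBurchard1999, §3.a] -/
private theorem hasTraversals_of_dist_lt_aux (h : γ₁.HasTraversals k x r R) (hd : dist γ₁ γ₂ < ε) :
    γ₂.HasTraversals k x (r + ε) (R - ε) := by
  rw [Curve.dist_def, Curve.reparamDist] at hd
  obtain ⟨φ, hφ⟩ := exists_lt_of_ciInf_lt hd
  refine hasTraversals_of_reparam_aux φ ?_
  have hpt : ∀ t, dist (γ₁ t) (γ₂.reparam φ t) < ε := fun t =>
    (ContinuousMap.dist_apply_le_dist (f := γ₁.toContinuousMap)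
      (g := (γ₂.reparam φ).toContinuousMap) t).trans_lt hφ
  obtain ⟨s, t, hst, hsep⟩ := h
  refine ⟨s, t, fun i => ?_, hsep⟩
  obtain ⟨hle, h⟩ := hst i
  refine ⟨hle, ?_⟩
  have h1 : ∀ u, dist (γ₁ u) x ≤ r → dist (γ₂.reparam φ u) x ≤ r + ε := fun u hu => by
    linarith [dist_triangle (γ₂.reparam φ u) (γ₁ u) x, dist_comm (γ₁ u) (γ₂.reparam φ u), hpt u]
  have h2 : ∀ u, R ≤ dist (γ₁ u) x → R - ε ≤ dist (γ₂.reparam φ u) x := fun u hu => by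
    linarith [dist_triangle (γ₁ u) (γ₂.reparam φ u) x, hpt u]
  rcases h with ⟨ha, hb⟩ | ⟨ha, hb⟩
  · exact Or.inl ⟨h1 _ ha, h2 _ hb⟩
  · exact Or.inr ⟨h2 _ ha, h1 _ hb⟩

end Curve

/-- **A compact set of curve classes traverses a genuine shell boundedly often**: for compact
`𝒦 ⊆ CurveClass E`, a centre `x` and radii `r < R`, there is `k` such that NO curve whose class
lies in `𝒦` traverses `D(x; r, R)` by `k` separate segments. Proof: cover `𝒦` by finitely many
balls of radius `(R - r)/3`, choose a representative of each centre and, by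
`Curve.exists_not_hasTraversals`, a threshold for the thinner shell `D(x; r + ε, R - ε)`; a curve in
the ball inherits the traversals with `ε` of room.
(Aizenman–Burchard 1999, §1.a–§2: uniform regularity on compact families.) [cite: AizenmanBurchard1999, §2] -/
theorem CurveClass.exists_not_hasTraversals_of_isCompact {𝒦 : Set (CurveClass E)}
    (h𝒦 : IsCompact 𝒦) (x : E) {r R : ℝ} (hrR : r < R) :
    ∃ k : ℕ, ∀ γ : Curve E, CurveClass.mk γ ∈ 𝒦 → ¬ γ.HasTraversals k x r R := by
  classical
  set ε : ℝ := (R - r) / 3 with hε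
  have hε0 : 0 < ε := by rw [hε]; linarith
  obtain ⟨T, -, hTfin, hcov⟩ := h𝒦.elim_finite_subcover_image (b := 𝒦)
    (c := fun c => Metric.ball c ε) (fun _ _ => Metric.isOpen_ball)
    (fun c hc => Set.mem_biUnion hc (Metric.mem_ball_self hε0))
  have hrep : ∀ c : CurveClass E, ∃ γ : Curve E, CurveClass.mk γ = c := fun c => by
    obtain ⟨γ, hγ⟩ := SeparationQuotient.surjective_mk c
    exact ⟨γ, by rw [CurveClass.mk_eq_separationQuotientMk]; exact hγ⟩
  choose rep hrep using hrep
  have hthr : ∀ c : CurveClass E, ∃ k, ¬ (rep c).HasTraversals k x (r + ε) (R - ε) := fun c =>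
    Curve.exists_not_hasTraversals _ _ (by rw [hε]; linarith)
  choose kc hkc using hthr
  refine ⟨hTfin.toFinset.sup kc + 1, fun γ hγ htr => ?_⟩
  obtain ⟨c, hcT, hγc⟩ := Set.mem_iUnion₂.1 (hcov hγ)
  have hdist : dist γ (rep c) < ε := by
    have := Metric.mem_ball.1 hγc
    rwa [← hrep c, CurveClass.dist_mk_mk] at this
  have hle : kc c ≤ hTfin.toFinset.sup kc + 1 :=
    (Finset.le_sup (f := kc) (hTfin.mem_toFinset.2 hcT)).trans (Nat.le_succ _)
  exact hkc c (Curve.hasTraversals_of_dist_lt_aux (htr.of_le hle) hdist)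

end Literature.Probability.RandomPlanarGeometry

end
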